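import Summits.QuantumFields.QCD.Theorems.QuarksAsStableActionStableActionBridgeSliceNilpotent
import Summits.QuantumFields.QCD.Theorems.QuarksAsStableActionStableActionBridgeFockLiftPosDef

/-!
# Unitarity of the slice gauge rotation and of its second quantisation
(helper for crux stmt-QuantumFields-9737 `QuarksAsStableAction.StableActionBridge`, line `Sketch` —
stubs `sliceGaugeRot_conjTranspose_mul_self` and `fockGaugeAct_conjTranspose_mul_self`)

A time-independent gauge transformation `g : TorusSite 3 S → SU(3)` acts on the quark modes
`flavour × (site × colour × spin)` of one time slice by the one-particle rotation
`ψ_{f,x,a,α} ↦ ∑_b g(x)_{ab} ψ_{f,x,b,α}` (Smit, *Introduction to Quantum Fields on a Lattice*,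
§4.6 (4.124)–(4.126)), the tree's `sliceGaugeRot g = R_c ⊗ 1` with the spin-blind colour rotation
`R_c = (δ_{ff'} δ_{xx'} g(x)_{ab})` (`sliceKron R_c 1`), and on the slice Fock space by its second
quantisation `fockGaugeAct g = Γ(R̃)`, `R̃` the rotation transported to the linear enumeration
`sliceQuarkEquiv` of the modes (Smit (4.125)–(4.127)).  Both are unitary:

* `R_c` is, up to the reassociation `(f, (x, a)) ↦ (a, (f, x))` of the index, the block-diagonal
  matrix with the `SU(3)` blocks `g(x)` (`colourRot_eq_submatrix_blockDiagonal`), so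
  `R_cᴴ R_c = 1 = R_c R_cᴴ` blockwise from `g(x)ᴴ g(x) = 1 = g(x) g(x)ᴴ`
  (`Matrix.blockDiagonal_conjTranspose`, `Matrix.blockDiagonal_mul`, `Matrix.blockDiagonal_one`);
* `(R_c ⊗ 1)ᴴ (R_c ⊗ 1) = (R_cᴴ R_c) ⊗ 1 = 1 ⊗ 1 = 1` by the landed `sliceKron` toolkit
  (`SliceNilpotent.sliceKron_conjTranspose`, `sliceKron_mul`, `sliceKron_one_one`);
* reindexing along an equivalence and the Fock functor `Γ = fockLift` both commute with `ᴴ` and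
  with products and preserve `1` (`Matrix.conjTranspose_submatrix`, `Matrix.submatrix_mul_equiv`,
  `Matrix.submatrix_one_equiv`; the landed `FockLiftPosDef.fockLift_conjTranspose`, `fockLift_mul`,
  `fockLift_one`), so `Γ(R̃)ᴴ Γ(R̃) = Γ(R̃ᴴ R̃) = Γ(1) = 1` and symmetrically.

The reusable pieces are exported in the sub-namespace `SliceGaugeUnitarity`.  Pure theorem file
(no definitions).

[cite: Smit2023, §4.6 (4.124)–(4.127)]
-/

noncomputable section

namespace Summit.QuantumFields.QCD.Cruxes.StableActionBridge.Sketch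

open MeasureTheory Matrix Literature.MathematicalPhysics.QuantumFieldTheory
  Literature.MathematicalPhysics.QuantumLattice
open Literature.Probability.LatticeModels (TorusSite)

namespace SliceGaugeUnitarity

variable {Nf S : ℕ}

/-! ### Generic transport of unitarity: blocks, reindexing, second quantisation -/

/-- A block-diagonal matrix with special-unitary blocks is unitary:
`(⊕ₖ Gₖ)ᴴ (⊕ₖ Gₖ) = ⊕ₖ Gₖᴴ Gₖ = 1` and `(⊕ₖ Gₖ)(⊕ₖ Gₖ)ᴴ = 1`. [folklore] -/
theorem blockDiagonal_coe_conjTranspose_mul_self {o : Type*} [Fintype o] [DecidableEq o]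
    {n : Type*} [Fintype n] [DecidableEq n] (G : o → Matrix.specialUnitaryGroup n ℂ) :
    (Matrix.blockDiagonal fun k => (G k : Matrix n n ℂ))ᴴ *
        Matrix.blockDiagonal (fun k => (G k : Matrix n n ℂ)) = 1 ∧
      Matrix.blockDiagonal (fun k => (G k : Matrix n n ℂ)) *
        (Matrix.blockDiagonal fun k => (G k : Matrix n n ℂ))ᴴ = 1 := by
  have h1 : ∀ k, (G k : Matrix n n ℂ)ᴴ * (G k : Matrix n n ℂ) = 1 := fun k =>
    Unitary.star_mul_self_of_mem (G k).prop.1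
  have h2 : ∀ k, (G k : Matrix n n ℂ) * (G k : Matrix n n ℂ)ᴴ = 1 := fun k =>
    Unitary.mul_star_self_of_mem (G k).prop.1
  refine ⟨?_, ?_⟩
  · rw [Matrix.blockDiagonal_conjTranspose, ← Matrix.blockDiagonal_mul]
    simp only [h1]
    exact Matrix.blockDiagonal_one
  · rw [Matrix.blockDiagonal_conjTranspose, ← Matrix.blockDiagonal_mul]
    simp only [h2]
    exact Matrix.blockDiagonal_one

/-- Reindexing a square matrix along an equivalence preserves unitarity:
`(M∘e)ᴴ (M∘e) = (Mᴴ M)∘e = 1` and `(M∘e)(M∘e)ᴴ = 1`. [folklore] -/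
theorem submatrix_equiv_conjTranspose_mul_self {m n : Type*} [Fintype m] [Fintype n]
    [DecidableEq m] [DecidableEq n] (e : n ≃ m) (M : Matrix m m ℂ)
    (h : Mᴴ * M = 1 ∧ M * Mᴴ = 1) :
    (M.submatrix ⇑e ⇑e)ᴴ * M.submatrix ⇑e ⇑e = 1 ∧
      M.submatrix ⇑e ⇑e * (M.submatrix ⇑e ⇑e)ᴴ = 1 := by
  rw [Matrix.conjTranspose_submatrix, Matrix.submatrix_mul_equiv, Matrix.submatrix_mul_equiv, h.1,
    h.2, Matrix.submatrix_one_equiv]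
  exact ⟨rfl, rfl⟩

/-- **Second quantisation preserves unitarity**: if `Xᴴ X = 1 = X Xᴴ` then
`Γ(X)ᴴ Γ(X) = Γ(Xᴴ X) = Γ(1) = 1` and `Γ(X) Γ(X)ᴴ = 1` for `Γ = fockLift`
(`Γ(Xᴴ) = Γ(X)ᴴ`, `Γ(XY) = Γ(X)Γ(Y)`, `Γ(1) = 1`). [cite: Smit2023, §4.6 (4.125)–(4.127)] -/
theorem fockLift_conjTranspose_mul_self {ι : Type*} [LinearOrder ι] [Fintype ι]
    (X : Matrix ι ι ℂ) (h : Xᴴ * X = 1 ∧ X * Xᴴ = 1) :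
    (fockLift X)ᴴ * fockLift X = 1 ∧ fockLift X * (fockLift X)ᴴ = 1 := by
  rw [← FockLiftPosDef.fockLift_conjTranspose, ← FockLiftPosDef.fockLift_mul,
    ← FockLiftPosDef.fockLift_mul, h.1, h.2, FockLiftPosDef.fockLift_one]
  exact ⟨rfl, rfl⟩

/-! ### The spin-blind colour rotation `R_c = (δ_{ff'} δ_{xx'} g(x)_{ab})` -/

/-- The colour rotation `R_c (f,x,a) (f',x',b) = δ_{ff'} δ_{xx'} g(x)_{ab}` of `sliceGaugeRot` is
the block-diagonal matrix of the blocks `g(x)` (one copy per flavour and site), transported along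
the reassociation `(f, (x, a)) ↦ (a, (f, x))` of the spin-blind index. [folklore] -/
theorem colourRot_eq_submatrix_blockDiagonal
    (g : TorusSite 3 S → Matrix.specialUnitaryGroup (Fin 3) ℂ) :
    (Matrix.of fun p q : SliceColourVar Nf S =>
        if p.1 = q.1 ∧ p.2.1 = q.2.1 then (g p.2.1 : Matrix (Fin 3) (Fin 3) ℂ) p.2.2 q.2.2 else 0) =
      (Matrix.blockDiagonal fun k : Fin Nf × TorusSite 3 S =>
          (g k.2 : Matrix (Fin 3) (Fin 3) ℂ)).submatrix
        ⇑((Equiv.prodAssoc (Fin Nf) (TorusSite 3 S) (Fin 3)).symm.trans (Equiv.prodComm _ _))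
        ⇑((Equiv.prodAssoc (Fin Nf) (TorusSite 3 S) (Fin 3)).symm.trans (Equiv.prodComm _ _)) := by
  ext ⟨f, x, a⟩ ⟨f', x', b⟩
  simp only [Matrix.of_apply, Matrix.submatrix_apply, Equiv.trans_apply,
    Equiv.prodAssoc_symm_apply, Equiv.prodComm_apply, Prod.swap_prod_mk,
    Matrix.blockDiagonal_apply', Prod.mk.injEq]

variable [NeZero S]

/-- **The colour rotation is unitary**: `R_cᴴ R_c = 1 = R_c R_cᴴ` for
`R_c (f,x,a) (f',x',b) = δ_{ff'} δ_{xx'} g(x)_{ab}`, from `g(x)ᴴ g(x) = 1 = g(x) g(x)ᴴ` blockwise.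
[cite: Smit2023, §4.6 (4.124)–(4.126)] -/
theorem colourRot_conjTranspose_mul_self
    (g : TorusSite 3 S → Matrix.specialUnitaryGroup (Fin 3) ℂ) :
    (Matrix.of fun p q : SliceColourVar Nf S =>
          if p.1 = q.1 ∧ p.2.1 = q.2.1 then (g p.2.1 : Matrix (Fin 3) (Fin 3) ℂ) p.2.2 q.2.2
          else 0)ᴴ *
        (Matrix.of fun p q : SliceColourVar Nf S =>
          if p.1 = q.1 ∧ p.2.1 = q.2.1 then (g p.2.1 : Matrix (Fin 3) (Fin 3) ℂ) p.2.2 q.2.2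
          else 0) = 1 ∧
      (Matrix.of fun p q : SliceColourVar Nf S =>
          if p.1 = q.1 ∧ p.2.1 = q.2.1 then (g p.2.1 : Matrix (Fin 3) (Fin 3) ℂ) p.2.2 q.2.2
          else 0) *
        (Matrix.of fun p q : SliceColourVar Nf S =>
          if p.1 = q.1 ∧ p.2.1 = q.2.1 then (g p.2.1 : Matrix (Fin 3) (Fin 3) ℂ) p.2.2 q.2.2
          else 0)ᴴ = 1 := by
  rw [colourRot_eq_submatrix_blockDiagonal]
  exact submatrix_equiv_conjTranspose_mul_self _ _
    (blockDiagonal_coe_conjTranspose_mul_self fun k : Fin Nf × TorusSite 3 S => g k.2)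

/-! ### `sliceGaugeRot g = R_c ⊗ 1` and `fockGaugeAct g = Γ(R̃)` are unitary -/

/-- **The one-particle gauge rotation of the slice quark modes is unitary**:
`(R_c ⊗ 1)ᴴ (R_c ⊗ 1) = (R_cᴴ R_c) ⊗ 1 = 1` and `(R_c ⊗ 1)(R_c ⊗ 1)ᴴ = 1`.
[cite: Smit2023, §4.6 (4.124)–(4.126)] -/
theorem sliceGaugeRot_unitary (g : TorusSite 3 S → Matrix.specialUnitaryGroup (Fin 3) ℂ) :
    (sliceGaugeRot (Nf := Nf) g)ᴴ * sliceGaugeRot g = 1 ∧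
      sliceGaugeRot (Nf := Nf) g * (sliceGaugeRot g)ᴴ = 1 := by
  obtain ⟨h1, h2⟩ := colourRot_conjTranspose_mul_self (Nf := Nf) g
  refine ⟨?_, ?_⟩
  · rw [sliceGaugeRot, SliceNilpotent.sliceKron_conjTranspose, SliceNilpotent.sliceKron_mul, h1,
      Matrix.conjTranspose_one, Matrix.mul_one, SliceNilpotent.sliceKron_one_one]
  · rw [sliceGaugeRot, SliceNilpotent.sliceKron_conjTranspose, SliceNilpotent.sliceKron_mul, h2,
      Matrix.conjTranspose_one, Matrix.mul_one, SliceNilpotent.sliceKron_one_one]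

/-- `sliceGaugeRot g` lies in the unitary group of the slice quark modes.
[cite: Smit2023, §4.6 (4.124)–(4.126)] -/
theorem sliceGaugeRot_mem_unitaryGroup
    (g : TorusSite 3 S → Matrix.specialUnitaryGroup (Fin 3) ℂ) :
    sliceGaugeRot (Nf := Nf) g ∈ Matrix.unitaryGroup (SliceQuarkVar Nf S) ℂ :=
  ⟨(sliceGaugeRot_unitary g).1, (sliceGaugeRot_unitary g).2⟩

/-- **The Fock-space gauge action `Γ(G_g)` is unitary**: the transported rotation
`R̃ = reindex sliceQuarkEquiv sliceQuarkEquiv (sliceGaugeRot g)` is unitary with `sliceGaugeRot g`,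
and `Γ` preserves unitarity. [cite: Smit2023, §4.6 (4.125)–(4.127)] -/
theorem fockGaugeAct_unitary (g : TorusSite 3 S → Matrix.specialUnitaryGroup (Fin 3) ℂ) :
    (fockGaugeAct (Nf := Nf) (S := S) g)ᴴ * fockGaugeAct g = 1 ∧
      fockGaugeAct (Nf := Nf) (S := S) g * (fockGaugeAct g)ᴴ = 1 := by
  rw [fockGaugeAct, Matrix.reindex_apply]
  exact fockLift_conjTranspose_mul_self _
    (submatrix_equiv_conjTranspose_mul_self _ _ (sliceGaugeRot_unitary g))

/-- `fockGaugeAct g` lies in the unitary group of the slice Fock space.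
[cite: Smit2023, §4.6 (4.125)–(4.127)] -/
theorem fockGaugeAct_mem_unitaryGroup
    (g : TorusSite 3 S → Matrix.specialUnitaryGroup (Fin 3) ℂ) :
    fockGaugeAct (Nf := Nf) (S := S) g ∈ Matrix.unitaryGroup (Finset (SliceFermiIdx Nf S)) ℂ :=
  ⟨(fockGaugeAct_unitary g).1, (fockGaugeAct_unitary g).2⟩

end SliceGaugeUnitarity

/-- **Stub `sliceGaugeRot_conjTranspose_mul_self` of line `Sketch`.**  The one-particle gauge
rotation `sliceGaugeRot g = R_c ⊗ 1` of the slice quark modes by a time-independent gauge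
transformation `g : TorusSite 3 S → SU(3)` (Smit §4.6 (4.124)–(4.126)) is unitary:
`(R_c ⊗ 1)ᴴ (R_c ⊗ 1) = 1 = (R_c ⊗ 1)(R_c ⊗ 1)ᴴ`, since `R_c` is block-diagonal with `SU(3)`
blocks. [cite: Smit2023, §4.6 (4.124)–(4.126)] -/
theorem sliceGaugeRot_conjTranspose_mul_self : ∀ (Nf S : ℕ) [NeZero S] (g : Literature.Probability.LatticeModels.TorusSite 3 S → Matrix.specialUnitaryGroup (Fin 3) ℂ), (sliceGaugeRot (Nf := Nf) g)ᴴ * sliceGaugeRot g = 1 ∧ sliceGaugeRot (Nf := Nf) g * (sliceGaugeRot g)ᴴ = 1 :=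
  fun _ _ _ g => SliceGaugeUnitarity.sliceGaugeRot_unitary g

/-- **Stub `fockGaugeAct_conjTranspose_mul_self` of line `Sketch`.**  The second-quantised gauge
action `fockGaugeAct g = Γ(R̃)` on the slice Fock space (Smit §4.6 (4.125)–(4.127)) is unitary:
`Γ(R̃)ᴴ Γ(R̃) = Γ(R̃ᴴ R̃) = Γ(1) = 1` and `Γ(R̃) Γ(R̃)ᴴ = 1`, the Fock functor `Γ = fockLift`
being multiplicative, `ᴴ`-preserving and unital. [cite: Smit2023, §4.6 (4.125)–(4.127)] -/
theorem fockGaugeAct_conjTranspose_mul_self : ∀ (Nf S : ℕ) [NeZero S] (g : Literature.Probability.LatticeModels.TorusSite 3 S → Matrix.specialUnitaryGroup (Fin 3) ℂ), (fockGaugeAct (Nf := Nf) (S := S) g)ᴴ * fockGaugeAct g = 1 ∧ fockGaugeAct (Nf := Nf) (S := S) g * (fockGaugeAct g)ᴴ = 1 :=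
  fun _ _ _ g => SliceGaugeUnitarity.fockGaugeAct_unitary g

end Summit.QuantumFields.QCD.Cruxes.StableActionBridge.Sketch

end
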